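import Mathlib.LinearAlgebra.Vandermonde
import Mathlib.Algebra.Polynomial.Taylor
import Mathlib.Algebra.Polynomial.HasseDeriv
import Mathlib.Algebra.Polynomial.RingDivision
import Mathlib.Algebra.Polynomial.BigOperators
import Mathlib.RingTheory.Coprime.Lemmas
import Literature.NumberTheory.Transcendental.BakerQuantVandermonde
import HarnessLib

/-!
# Waldschmidt 1980, §3.5 "The contradiction": the algebraic endgame of the Kummer descent

Support file (theorems only, no definitions, no named facts) for the archimedean input of the
Stewart–Yu 1991 line of `Literature.Barriers.ABC.stewartYu1991_upperBound`
(`BakerMethodBoundsStewartYu1991LineProofs.lean`, binder `hW₂` = M. Waldschmidt, *A lower bound for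
linear forms in logarithms*, Acta Arith. **37** (1980), Prop. 3.8 over `ℚ` with `q = 2`).

Waldschmidt's proof of Proposition 3.1 (§3, pp. 263–274) ends as follows (§3.5, p. 274). After
`J₀ = [log Lₙ / log q] + 1` steps of the main inductive argument the last exponent range is empty
(`Lₙ^{(J₀)} = 0`), and the vanishing of the algebraic numbers `φ_{J₀,τ}(s)` reads

`∑_{λ₋₁,λ₀,λ₁,…,λ_{n-1}} p(λ) Δ(q^{-J₀}s + λ₋₁; L₋₁+1; λ₀+1; τ₀) · α₁^{λ₁ s} ⋯ α_{n-1}^{λ_{n-1} s}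
  · λ₁^{τ₁} ⋯ λ_{n-1}^{τ_{n-1}} = 0`

for all `s ≤ q^{J₀} S` prime to `q` and all `τ` with `|τ| ≤ q^{-J₀} T`, in particular for
`τ₀ < T'`, `0 ≤ τⱼ ≤ Lⱼ^{(J₀)}`. "Since the Vandermonde determinant `|λ_{n-1}^{τ_{n-1}}|` does not
vanish, the new sum in parenthesis above is zero. By arguing `n − 1` times in the same way, we
obtain `∑_{λ₋₁,λ₀} p(λ₋₁, λ₀, …, λ_{n-1}, 0) Δ(q^{-J₀}s + λ₋₁; L₋₁+1; λ₀+1; t) = 0` … This implies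
that each polynomial `∑ p(λ) Δ(z + λ₋₁; L₋₁+1; λ₀+1; 0)` has at least `½q^{-J₀}T · ½q^{J₀}S` zeros;
but since these polynomials have degree at most `L₋₁L₀`, it follows that `p^{(J₀)}(λ) = 0`,
contrary to construction." (p. 274.)

This file proves that deduction as three abstract statements over any field `K` of
characteristic zero, in the form in which the main file will use them (the polynomial family is
arbitrary with pairwise distinct degrees — in the sequel it is Baker's triangular family
`Δ(X; λ₋₁) Δ(X; h)^{λ₀}` of `BakerQuantDelta.wPoly`, as in the tree's Baker 1975 Ch. 3 and
Cijsouw–Waldschmidt 1977 files — and derivatives are Hasse derivatives, which changes each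
vanishing condition only by the non-zero factor `τ₀!`):

* `eq_zero_of_hasseDeriv_eval_eq_zero_of_natDegree_lt` — a polynomial whose Hasse derivatives of
  order `< T` vanish at the points of a finite set `E` with `deg P < T · #E` is zero (Taylor
  expansion `⇒ (X − r)^T ∣ P`, coprimality, degree count);
* `eq_zero_of_forall_sum_mul_prod_pow_eq_zero` — the tensor-power Vandermonde step: if
  `∑_λ C(λ) ∏ⱼ λⱼ^{τⱼ} = 0` for all `τ` in the box `0 ≤ τⱼ ≤ Lⱼ` (`λ` in the same box), then `C = 0`
  (induction on the number of coordinates, Mathlib's `Matrix.eq_zero_of_forall_pow_sum_mul_pow_eq_zero`);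
* `endgame` — **§3.5 assembled**: if
  `∑_a ∑_λ p(a, λ) · (Hasse-∂^{k} w_a)(e(s)) · ∏ⱼ xⱼ^{s λⱼ} λⱼ^{τⱼ} = 0` for all `s ∈ 𝒮`, `k < T`,
  `τ` in the box, with `xⱼ ≠ 0`, `e` injective on `𝒮`, the `w_a` non-zero of pairwise distinct
  degrees `≤ N`, and `N < T · #𝒮`, then `p = 0`.

Nothing here is specific to `ℂ`: for rational `αⱼ` all the numbers involved are rational. The
analytic part of §3 (Lemmas 3.3–3.7) and the main inductive argument are not in this file.

## References

* [Waldschmidt1980] M. Waldschmidt, *A lower bound for linear forms in logarithms*, Acta Arith. 37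
  (1980), 257–283 — §3.5 (p. 274); Lemma 2.4 (p. 261, linear independence of the `Δ`-powers).
* [BakerTNT1975] A. Baker, *Transcendental Number Theory*, CUP 1975, Ch. 3 §2 Lemma 2 (the tree's
  `Baker1975.Ch3.eq_zero_of_sum_smul_eq_zero_of_natDegree_injOn`, used for the last step).
-/

noncomputable section

open Finset Polynomial

namespace Literature.NumberTheory.Transcendental.Waldschmidt1980

variable {K : Type*} [Field K]

/-! ### Zeros with multiplicity from vanishing Hasse derivatives -/

/-- **Multiplicity from Hasse derivatives**: if `((1/k!) dᵏ P)(r) = 0` for all `k < T` then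
`(X − r)^T ∣ P` (Taylor's formula `P = ∑ₖ ((1/k!)dᵏP)(r) (X − r)ᵏ`). [folklore] -/
theorem X_sub_C_pow_dvd_of_hasseDeriv_eval_eq_zero (P : K[X]) (r : K) (T : ℕ)
    (h : ∀ k < T, (hasseDeriv k P).eval r = 0) : (X - C r) ^ T ∣ P := by
  have hT := sum_taylor_eq P r
  rw [← hT, Polynomial.sum_def]
  refine Finset.dvd_sum fun i hi => ?_
  by_cases hiT : T ≤ i
  · exact (pow_dvd_pow (X - C r) hiT).mul_left _
  · exfalso
    have h0 : (taylor r P).coeff i = 0 := by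
      rw [taylor_coeff]; exact h i (by omega)
    exact (mem_support_iff.mp hi) h0

/-- **Multiplicity at several points**: if the Hasse derivatives of order `< T` of `P` vanish at
every point of the finite set `E`, then `∏_{r ∈ E} (X − r)^T ∣ P`. [folklore] -/
theorem prod_X_sub_C_pow_dvd_of_hasseDeriv_eval_eq_zero (P : K[X]) (E : Finset K) (T : ℕ)
    (h : ∀ r ∈ E, ∀ k < T, (hasseDeriv k P).eval r = 0) :
    ∏ r ∈ E, (X - C r) ^ T ∣ P := by
  refine Finset.prod_dvd_of_coprime ?_ fun r hr =>
    X_sub_C_pow_dvd_of_hasseDeriv_eval_eq_zero P r T (h r hr)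
  intro a _ b _ hab
  have hc : IsCoprime (X - C a) (X - C b) :=
    (pairwise_coprime_X_sub_C (K := K) (s := fun x : K => x) (fun _ _ h => h)) hab
  exact hc.pow

/-- **A polynomial with too many zeros vanishes** (Waldschmidt 1980, p. 274: "each polynomial … has
at least `½q^{-J₀}T · ½q^{J₀}S` zeros; but since these polynomials have degree at most `L₋₁L₀`, it
follows that …"): if the Hasse derivatives of order `< T` of `P` vanish on `E` and
`deg P < T · #E`, then `P = 0`. [cite: Waldschmidt1980, §3.5 (p. 274)] -/
theorem eq_zero_of_hasseDeriv_eval_eq_zero_of_natDegree_lt (P : K[X]) (E : Finset K) (T : ℕ)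
    (h : ∀ r ∈ E, ∀ k < T, (hasseDeriv k P).eval r = 0) (hdeg : P.natDegree < T * E.card) :
    P = 0 := by
  by_contra hP
  have hdvd := prod_X_sub_C_pow_dvd_of_hasseDeriv_eval_eq_zero P E T h
  have hmonic : ∀ r ∈ E, ((X - C r) ^ T : K[X]).Monic := fun r _ => (monic_X_sub_C r).pow T
  have hdegD : (∏ r ∈ E, (X - C r) ^ T).natDegree = T * E.card := by
    rw [natDegree_prod_of_monic _ _ hmonic]
    simp only [natDegree_pow, natDegree_X_sub_C, mul_one, Finset.sum_const, smul_eq_mul]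
    ring
  have hle := natDegree_le_of_dvd hdvd hP
  omega

/-! ### The Vandermonde step -/

/-- **The tensor-power Vandermonde argument** (Waldschmidt 1980, p. 274: "Since the Vandermonde
determinant `|λ_{n-1}^{τ_{n-1}}|` (`0 ≤ λ_{n-1}, τ_{n-1} ≤ L_{n-1}^{(J₀)}`) does not vanish, the new
sum in parenthesis above is zero. By arguing `n − 1` times in the same way …"): over a field of
characteristic zero, if `C : ∏ⱼ [0, Lⱼ] → K` satisfies `∑_λ C(λ) ∏ⱼ λⱼ^{τⱼ} = 0` for every `τ` in
the same box, then `C = 0`. [cite: Waldschmidt1980, §3.5 (p. 274)] -/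
theorem eq_zero_of_forall_sum_mul_prod_pow_eq_zero [CharZero K] :
    ∀ (m : ℕ) (L : Fin m → ℕ) (Cf : (∀ j : Fin m, Fin (L j + 1)) → K),
      (∀ τ : ∀ j : Fin m, Fin (L j + 1),
          ∑ lam : ∀ j : Fin m, Fin (L j + 1), Cf lam * ∏ j, ((lam j : ℕ) : K) ^ (τ j : ℕ) = 0) →
      Cf = 0
  | 0, L, Cf, h => by
      funext lam
      have h1 := h lam
      rw [Fintype.sum_subsingleton _ lam] at h1
      simpa using h1
  | m + 1, L, Cf, h => by
      -- the coefficient of `a^{τ₀}` after summing out the other coordinates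
      have key : ∀ (τ' : ∀ i : Fin m, Fin (L i.succ + 1)) (τ₀ : Fin (L 0 + 1)),
          ∑ a : Fin (L 0 + 1), (∑ lam' : ∀ i : Fin m, Fin (L i.succ + 1),
              Cf (Fin.cons a lam') * ∏ i, ((lam' i : ℕ) : K) ^ (τ' i : ℕ)) *
            ((a : ℕ) : K) ^ (τ₀ : ℕ) = 0 := by
        intro τ' τ₀
        have h1 := h (Fin.cons τ₀ τ')
        rw [← (Fin.consEquiv fun j => Fin (L j + 1)).sum_comp, Fintype.sum_prod_type] at h1
        refine Eq.trans ?_ h1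
        refine Finset.sum_congr rfl fun a _ => ?_
        rw [Finset.sum_mul]
        refine Finset.sum_congr rfl fun lam' _ => ?_
        have hce : (Fin.consEquiv fun j => Fin (L j + 1)) (a, lam') = Fin.cons a lam' := rfl
        rw [hce, Fin.prod_univ_succ]
        simp only [Fin.cons_zero, Fin.cons_succ]
        ring
      have hinj : Function.Injective fun a : Fin (L 0 + 1) => ((a : ℕ) : K) := by
        intro a b hab
        have hab' : ((a : ℕ) : K) = ((b : ℕ) : K) := hab
        exact Fin.ext (by exact_mod_cast hab')
      -- Vandermonde in the first coordinate, for each `τ'`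
      have hd : ∀ (τ' : ∀ i : Fin m, Fin (L i.succ + 1)) (a : Fin (L 0 + 1)),
          ∑ lam' : ∀ i : Fin m, Fin (L i.succ + 1),
            Cf (Fin.cons a lam') * ∏ i, ((lam' i : ℕ) : K) ^ (τ' i : ℕ) = 0 := by
        intro τ' a
        have hv := Matrix.eq_zero_of_forall_pow_sum_mul_pow_eq_zero hinj (key τ')
        exact congrFun hv a
      -- induction on the remaining coordinates, for each value `a` of the first one
      have hrec : ∀ a : Fin (L 0 + 1),
          (fun lam' : ∀ i : Fin m, Fin (L i.succ + 1) => Cf (Fin.cons a lam')) = 0 := fun a =>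
        eq_zero_of_forall_sum_mul_prod_pow_eq_zero m (fun i => L i.succ)
          (fun lam' => Cf (Fin.cons a lam')) (fun τ' => hd τ' a)
      funext lam
      have h2 := congrFun (hrec (lam 0)) (Fin.tail lam)
      simp only [Fin.cons_self_tail, Pi.zero_apply] at h2
      simpa using h2

/-- The Vandermonde step with non-zero weights: if
`∑_λ C(λ) (∏ⱼ yⱼ(λ)) ∏ⱼ λⱼ^{τⱼ} = 0` for all `τ` in the box and the weights `∏ⱼ yⱼ(λ)` are products of
non-zero factors (in §3.5: `yⱼ(λ) = αⱼ^{λⱼ s}`), then `C = 0`. [cite: Waldschmidt1980, §3.5 (p. 274)] -/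
theorem eq_zero_of_forall_sum_mul_prod_mul_pow_eq_zero [CharZero K] {m : ℕ} (L : Fin m → ℕ)
    (Cf : (∀ j : Fin m, Fin (L j + 1)) → K) (y : Fin m → ℕ → K) (hy : ∀ j t, y j t ≠ 0)
    (h : ∀ τ : ∀ j : Fin m, Fin (L j + 1),
      ∑ lam : ∀ j : Fin m, Fin (L j + 1),
        Cf lam * ∏ j, (y j (lam j : ℕ) * ((lam j : ℕ) : K) ^ (τ j : ℕ)) = 0) :
    Cf = 0 := by
  have h0 := eq_zero_of_forall_sum_mul_prod_pow_eq_zero m L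
    (fun lam => Cf lam * ∏ j, y j (lam j : ℕ)) (fun τ => by
      refine Eq.trans ?_ (h τ)
      refine Finset.sum_congr rfl fun lam _ => ?_
      rw [Finset.prod_mul_distrib]; ring)
  funext lam
  have h1 := congrFun h0 lam
  simp only [Pi.zero_apply, mul_eq_zero] at h1
  rcases h1 with h1 | h1
  · exact h1
  · exact absurd h1 (Finset.prod_ne_zero_iff.mpr fun j _ => hy j _)

/-! ### §3.5 assembled -/

/-- **Waldschmidt 1980, §3.5 — the contradiction, abstract form.** Let `w_a` (`a ∈ A`) be non-zero
polynomials over a field of characteristic zero with pairwise distinct degrees, all `≤ N`; let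
`xⱼ ≠ 0` (`j < m`), let `e` be injective on the finite set `𝒮 ⊆ ℕ` of points, and `N < T · #𝒮`.
If the coefficients `p(a, λ)` (`λ` in the box `0 ≤ λⱼ ≤ Lⱼ`) satisfy
`∑_a ∑_λ p(a, λ) · ((1/k!) dᵏ w_a)(e(s)) · ∏ⱼ xⱼ^{s λⱼ} λⱼ^{τⱼ} = 0`
for all `s ∈ 𝒮`, all `k < T` and all `τ` in the box, then `p = 0`. In §3.5 this is applied at the
last step `J₀` of the descent, with `w_{(λ₋₁,λ₀)}` the `Δ`-polynomials, `xⱼ = αⱼ`, `e(s) = q^{-J₀}s`,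
`𝒮 = {s ≤ q^{J₀}S, (s,q) = 1}`, `T = ½q^{-J₀}T`: first the Vandermonde step
(`eq_zero_of_forall_sum_mul_prod_mul_pow_eq_zero`) in the `λⱼ`, then the zero count
(`eq_zero_of_hasseDeriv_eval_eq_zero_of_natDegree_lt`) and the linear independence of the `w_a`
(Lemma 2.4; here `Baker1975.Ch3.eq_zero_of_sum_smul_eq_zero_of_natDegree_injOn`).
[cite: Waldschmidt1980, §3.5 (p. 274)] -/
theorem endgame [CharZero K] {A : Type*} [Fintype A] [DecidableEq A] (w : A → K[X])
    (hw0 : ∀ a, w a ≠ 0) (hwdeg : Function.Injective fun a => (w a).natDegree)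
    {N : ℕ} (hN : ∀ a, (w a).natDegree ≤ N)
    {m : ℕ} (L : Fin m → ℕ) (x : Fin m → K) (hx : ∀ j, x j ≠ 0)
    (pts : Finset ℕ) (e : ℕ → K) (he : Set.InjOn e pts) (T : ℕ) (hcount : N < T * pts.card)
    (p : A → (∀ j : Fin m, Fin (L j + 1)) → K)
    (hvan : ∀ s ∈ pts, ∀ k < T, ∀ τ : ∀ j : Fin m, Fin (L j + 1),
      ∑ a, ∑ lam : ∀ j : Fin m, Fin (L j + 1),
        p a lam * (hasseDeriv k (w a)).eval (e s) *
          ∏ j, (x j ^ (s * (lam j : ℕ)) * ((lam j : ℕ) : K) ^ (τ j : ℕ)) = 0) :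
    p = 0 := by
  classical
  -- Step 1 (Vandermonde): for each point and each order, the `λ`-coefficients vanish.
  have step1 : ∀ s ∈ pts, ∀ k < T, ∀ lam : ∀ j : Fin m, Fin (L j + 1),
      ∑ a, p a lam * (hasseDeriv k (w a)).eval (e s) = 0 := by
    intro s hs k hk
    have hC := eq_zero_of_forall_sum_mul_prod_mul_pow_eq_zero L
      (fun lam => ∑ a, p a lam * (hasseDeriv k (w a)).eval (e s))
      (fun j t => x j ^ (s * t)) (fun j t => pow_ne_zero _ (hx j)) (fun τ => by
        refine Eq.trans ?_ (hvan s hs k hk τ)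
        conv_rhs => rw [Finset.sum_comm]
        refine Finset.sum_congr rfl fun lam _ => ?_
        rw [Finset.sum_mul])
    intro lam
    exact congrFun hC lam
  -- Step 2 (zero count and linear independence): each `P_λ = ∑_a p(a,λ) w_a` vanishes.
  funext a lam
  set P : K[X] := ∑ a, p a lam • w a with hP
  have hPD : ∀ (k : ℕ) (r : K),
      (hasseDeriv k P).eval r = ∑ a, p a lam * (hasseDeriv k (w a)).eval r := by
    intro k r
    rw [hP, map_sum, eval_finsetSum]
    refine Finset.sum_congr rfl fun a _ => ?_
    rw [map_smul, eval_smul, smul_eq_mul]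
  have hzero : P = 0 := by
    refine eq_zero_of_hasseDeriv_eval_eq_zero_of_natDegree_lt P (pts.image e) T ?_ ?_
    · intro r hr k hk
      obtain ⟨s, hs, rfl⟩ := Finset.mem_image.mp hr
      rw [hPD]
      exact step1 s hs k hk lam
    · rw [Finset.card_image_of_injOn he]
      refine lt_of_le_of_lt ?_ hcount
      rw [hP]
      exact natDegree_sum_le_of_forall_le _ _ fun a _ => (natDegree_smul_le _ _).trans (hN a)
  have hind := Baker1975.Ch3.eq_zero_of_sum_smul_eq_zero_of_natDegree_injOn Finset.univ w
    (fun a _ => hw0 a) (fun a _ b _ h => hwdeg h) (fun a => p a lam) (by rw [← hP]; exact hzero)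
  simpa using hind a (Finset.mem_univ a)

end Literature.NumberTheory.Transcendental.Waldschmidt1980

end
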